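import Summits.NavierStokesRegularity.NavierStokesRegularity.Theorems.PerpetualPumpAveragedTypeIBlowupDieGlobalUnique
import Summits.NavierStokesRegularity.NavierStokesRegularity.Theorems.PerpetualPumpAveragedTypeIBlowupChainContinuation
import HarnessLib

/-!
# `PerpetualPump.PumpTransfer` (stmt-NavierStokesRegularity-1837), line `Sketch`: stub `noLonger`

Weighted blow-up of a chain solution forbids a longer chain solution (`stub_noLonger` of the lead's
skeleton `Cruxes/PumpTransfer/Lines/Sketch.lean`, v3; statement registered verbatim).

The exact band-kernel Volterra chain of Tao's averaged Navier–Stokes cascade (J. Amer. Math. Soc. 29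
(2016), §4 p. 22 (4.14)) is
`Y_{i,n}(t) = A 1_{(i,n)=(i₀,n₀)} k_{i,n}(t) + ∫₀ᵗ k_{i,n}(t-s) quadTerm(Y)_{i,n}(s) ds` with the heat kernels
of the modes `k_{i,n}(τ) = Re⟨e^{τΔ}ψ_{i,n}, ψ_{i,n}⟩` (continuous, `|k_{i,n}| ≤ 1`:
`continuous_re_pairing_heat_cascadeWavelet`, `abs_re_pairing_heat_cascadeWavelet_le` of crux #3's landed
`Theorems/PerpetualPumpAveragedTypeIBlowupChainContinuation.lean`). "The class" of a chain solution on
`[0,S)`: continuous on `[0,S)`, no modes below `n₀`, `(1+ε₀)^{20n}`-bounded on every compact `[0,S']`,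
`S' < S`, and the identity.

Proof: a class solution `Y'` on a longer `[0,S')`, `S' > S`, agrees with `Y` on `[0,S)` by uniqueness in
the class (`chain_unique`, landed in `Theorems/PerpetualPumpAveragedTypeIBlowupDieGlobalUnique.lean`), and
is `(1+ε₀)^{20n}`-bounded by some `C` on the compact `[0,S] ⊂ [0,S')` while vanishing below `n₀`; hence
`(1+ε₀)^{10n}|Y_{i,n}(t)| = (1+ε₀)^{-10n}(1+ε₀)^{20n}|Y'_{i,n}(t)| ≤ (1+ε₀)^{-10n₀} C` for `t ∈ [0,S)`,
`n ≥ n₀` (and `= 0` for `n < n₀`), contradicting the weighted unboundedness of `Y` on `[0,S)`.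

References: T. Tao, J. Amer. Math. Soc. 29 (2016), 601–674 = arXiv:1402.0290v3, §4 p. 22 (4.14).
[`Tao2016AveragedNS`]
-/

noncomputable section

-- the nested summit namespace is the tree's layout (D-0017)
set_option linter.dupNamespace false

namespace Summit.NavierStokesRegularity.NavierStokesRegularity.Theorems.PerpetualPumpPumpTransfer

open MeasureTheory Set Filter Topology
open scoped ENNReal
open Literature.Analysis.FluidPDE Literature.Analysis.FluidPDE.Tao2016
open Literature.Analysis.FluidPDE.TaoCascade (quadTerm IsSymmetricCoeff IsCancellingCoeff)
open Summit.NavierStokesRegularity.NavierStokesRegularity.Theorems.PerpetualPumpAveragedTypeIBlowup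

/-- **Stub `noLonger` (riskless): weighted blow-up forbids a longer chain solution.** If a chain solution `Y`
on `[0,S)` in the class of stmt-1835 is unbounded in the weight `(1+ε₀)^{10n}`, no chain solution from the same
datum exists on any `[0,S')`, `S' > S`: by uniqueness in the class (`chain_unique`, landed in
`Theorems/PerpetualPumpAveragedTypeIBlowupDieGlobalUnique.lean`, with `|k| ≤ 1` and continuity of the band
kernel from `Theorems/PerpetualPumpAveragedTypeIBlowupChainContinuation.lean`) the longer solution agrees with
`Y` on `[0,S)`, and it is `(1+ε₀)^{20n}`-bounded on the compact `[0,S]` while vanishing below `n₀` — so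
`(1+ε₀)^{10n}|Y| ≤ C (1+ε₀)^{-10 n₀}` on `[0,S)`, a contradiction. [folklore] -/
theorem stub_noLonger :
    ∀ {ε₀ : ℝ}, 0 < ε₀ → ε₀ ≤ 1 → ∀ {m : ℕ} (𝒟 : CascadeWaveletData ε₀ m)
      (α : Fin m → Fin m → Fin m → ℤ × ℤ × ℤ → ℝ) (i₀ : Fin m) (n₀ : ℤ) (A S : ℝ)
      (Y : Fin m → ℤ → ℝ → ℝ), 0 < S →
      (∀ i n, ContinuousOn (Y i n) (Ico 0 S)) →
      (∀ i n t, n < n₀ → Y i n t = 0) →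
      (∀ S' : ℝ, S' < S → ∃ C : ℝ, ∀ (i : Fin m) (n : ℤ), ∀ t ∈ Icc 0 S',
        (1 + ε₀) ^ ((20 : ℝ) * n) * |Y i n t| ≤ C) →
      (∀ (i : Fin m) (n : ℤ), ∀ t ∈ Ico 0 S,
        Y i n t = (if i = i₀ ∧ n = n₀ then A else 0) *
            (pairing (heat t (cascadeWavelet ε₀ (𝒟.ψ i) n)) (cascadeWavelet ε₀ (𝒟.ψ i) n)).re +
          ∫ s in (0 : ℝ)..t,
            (pairing (heat (t - s) (cascadeWavelet ε₀ (𝒟.ψ i) n)) (cascadeWavelet ε₀ (𝒟.ψ i) n)).re *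
              quadTerm ε₀ α Y i n s) →
      (∀ C : ℝ, ∃ t ∈ Ico 0 S, ∃ (i : Fin m) (n : ℤ), C < (1 + ε₀) ^ ((10 : ℝ) * n) * |Y i n t|) →
      ¬ ∃ (S' : ℝ) (Y' : Fin m → ℤ → ℝ → ℝ), S < S' ∧
        (∀ i n, ContinuousOn (Y' i n) (Ico 0 S')) ∧
        (∀ i n t, n < n₀ → Y' i n t = 0) ∧
        (∀ S'' : ℝ, S'' < S' → ∃ C : ℝ, ∀ (i : Fin m) (n : ℤ), ∀ t ∈ Icc 0 S'',
          (1 + ε₀) ^ ((20 : ℝ) * n) * |Y' i n t| ≤ C) ∧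
        (∀ (i : Fin m) (n : ℤ), ∀ t ∈ Ico 0 S',
          Y' i n t = (if i = i₀ ∧ n = n₀ then A else 0) *
              (pairing (heat t (cascadeWavelet ε₀ (𝒟.ψ i) n)) (cascadeWavelet ε₀ (𝒟.ψ i) n)).re +
            ∫ s in (0 : ℝ)..t,
              (pairing (heat (t - s) (cascadeWavelet ε₀ (𝒟.ψ i) n)) (cascadeWavelet ε₀ (𝒟.ψ i) n)).re *
                quadTerm ε₀ α Y' i n s) := by
  intro ε₀ hε₀ _hε₁ m 𝒟 α i₀ n₀ A S Y _hS hcont hlow hdec hchain hunb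
  rintro ⟨S', Y', hSS', hcont', hlow', hdec', hchain'⟩
  have hL0 : 0 < 1 + ε₀ := by linarith
  have hL1 : 1 ≤ 1 + ε₀ := by linarith
  -- uniqueness in the class: `Y = Y'` on `[0, min S S') = [0, S)`
  have huniq : ∀ (i : Fin m) (n : ℤ), ∀ t ∈ Ico 0 (min S S'), Y i n t = Y' i n t :=
    chain_unique hε₀ α
      (fun i n τ => (pairing (heat τ (cascadeWavelet ε₀ (𝒟.ψ i) n)) (cascadeWavelet ε₀ (𝒟.ψ i) n)).re)
      (fun i n τ => abs_re_pairing_heat_cascadeWavelet_le hε₀ 𝒟 i n τ)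
      (fun i n => continuous_re_pairing_heat_cascadeWavelet 𝒟 i n) i₀ n₀ A
      hcont hlow hdec hchain hcont' hlow' hdec' hchain'
  have hmin : min S S' = S := min_eq_left hSS'.le
  -- the weighted bound of `Y'` on the compact `[0, S]`
  obtain ⟨C, hC⟩ := hdec' S hSS'
  -- unboundedness of `Y` beyond the transported bound
  obtain ⟨t, ht, i, n, hlt⟩ := hunb (|C| * (1 + ε₀) ^ (-((10 : ℝ) * n₀)))
  have hB0 : 0 ≤ |C| * (1 + ε₀) ^ (-((10 : ℝ) * n₀)) :=
    mul_nonneg (abs_nonneg _) (Real.rpow_nonneg hL0.le _)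
  rcases lt_or_ge n n₀ with hn | hn
  · -- below the datum scale `Y` vanishes
    rw [hlow i n t hn, abs_zero, mul_zero] at hlt
    exact absurd hlt (not_lt.2 hB0)
  · -- `n ≥ n₀`: transport the bound of `Y'` through `Y = Y'`
    have hYY' : Y i n t = Y' i n t := huniq i n t (hmin.symm ▸ ht)
    have htS : t ∈ Icc 0 S := ⟨ht.1, ht.2.le⟩
    have hb : (1 + ε₀) ^ ((20 : ℝ) * n) * |Y' i n t| ≤ C := hC i n t htS
    have hsplit : (1 + ε₀) ^ ((10 : ℝ) * n) =
        (1 + ε₀) ^ (-((10 : ℝ) * n)) * (1 + ε₀) ^ ((20 : ℝ) * n) := by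
      rw [← Real.rpow_add hL0]
      congr 1
      ring
    have hmono : (1 + ε₀) ^ (-((10 : ℝ) * n)) ≤ (1 + ε₀) ^ (-((10 : ℝ) * n₀)) := by
      apply Real.rpow_le_rpow_of_exponent_le hL1
      have : (n₀ : ℝ) ≤ n := by exact_mod_cast hn
      linarith
    have hle : (1 + ε₀) ^ ((10 : ℝ) * n) * |Y i n t| ≤ |C| * (1 + ε₀) ^ (-((10 : ℝ) * n₀)) := by
      calc (1 + ε₀) ^ ((10 : ℝ) * n) * |Y i n t|
          = (1 + ε₀) ^ (-((10 : ℝ) * n)) * ((1 + ε₀) ^ ((20 : ℝ) * n) * |Y' i n t|) := by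
            rw [hsplit, hYY', mul_assoc]
        _ ≤ (1 + ε₀) ^ (-((10 : ℝ) * n)) * |C| :=
            mul_le_mul_of_nonneg_left (hb.trans (le_abs_self C)) (Real.rpow_nonneg hL0.le _)
        _ ≤ (1 + ε₀) ^ (-((10 : ℝ) * n₀)) * |C| :=
            mul_le_mul_of_nonneg_right hmono (abs_nonneg _)
        _ = |C| * (1 + ε₀) ^ (-((10 : ℝ) * n₀)) := mul_comm _ _
    exact absurd hlt (not_lt.2 hle)

end Summit.NavierStokesRegularity.NavierStokesRegularity.Theorems.PerpetualPumpPumpTransfer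

end
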